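import Mathlib
import Literature.Combinatorics.Enumerative.EulerZigzagGeneratingFunction
import HarnessLib

/-!
# Hoffman's generating functions `P(u,t)`, `Q(u,t)` of the derivative polynomials of `tan` and `sec`,
# `Pₙ(1) = 2ⁿEₙ`, Theorem 3.1, and the Springer numbers `bₙ = Qₙ(1)`, `dₙ = Pₙ(1) − Qₙ(1)`

Topic `Combinatorics/Enumerative`, namespace `Literature.Combinatorics.Enumerative.DerivativePolynomials`.
Continues the tree's Brent–Zimmermann derivative polynomials `TangentNumbers.P n`, `TangentNumbers.Q n ∈ ℕ[X]`
(`dⁿ tan x/dxⁿ = Pₙ(tan x)`, `dⁿ sec x/dxⁿ = Qₙ(tan x) sec x`; recurrence (4.63) = Knuth–Buckholtz) and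
`EulerZigzagGeneratingFunction.lean` (`tanSeries`, `secSeries`, André's theorem, the junction `Eₙ ↔ Tₖ, Sₖ`).
Two definitions (`egfP u = P(u,t)`, `egfQ u = Q(u,t)`, the exponential generating functions at a point `u`
of a field `K ⊇ ℚ`, as formal power series in `t`); everything else PROVED; no named fact, no `sorry`, no
instance, no notation.

## Source, verbatim

M. E. Hoffman, *Derivative polynomials, Euler polynomials, and associated integer sequences*, Electron.
J. Combin. 6 (1999) #R21 [Hoffman1999DerivativePolynomials] (held: `paper:doi-10-37236-1453`, pp. 1–8):

> §1. «Consider the sequences Pₙ and Qₙ of "derivative polynomials" defined by dⁿ/dxⁿ tan x = Pₙ(tan x)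
> and dⁿ/dxⁿ sec x = Qₙ(tan x) sec x for integer n ≥ 0. As shown in [12], their exponential generating
> functions P(u,t) = Σ_{n≥0} Pₙ(u)tⁿ/n! and Q(u,t) = Σ_{n≥0} Qₙ(u)tⁿ/n! are given by the explicit formulas
> (1) P(u,t) = (sin t + u cos t)/(cos t − u sin t) and Q(u,t) = 1/(cos t − u sin t).»
> §2. «From the chain rule it follows that the polynomials Pₙ satisfy P₀(u) = u and
> P_{n+1}(u) = (u² + 1)Pₙ′(u), n ≥ 0, and similarly Q₀(u) = 1 and Q_{n+1}(u) = (u² + 1)Qₙ′(u) + uQₙ(u).»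
> «Theorem 2.1. Let n ≥ 0. Then Pₙ(u) is a polynomial of degree n + 1 consisting of even powers with
> positive integral coefficients when n is odd and of odd powers with positive integral coefficients when n
> is even; and Qₙ(u) is a polynomial of degree n consisting of even powers with positive integral
> coefficients when n is even and of odd powers with positive integral coefficients when n is odd. In
> particular, for n ≥ 0 we have Pₙ(−u) = (−1)ⁿ⁺¹Pₙ(u) and Qₙ(−u) = (−1)ⁿQₙ(u).»
> «(3) P(P(u,t),s) = P(u,t+s) and Q(P(u,t),s)Q(u,t) = Q(u,t+s); these follow from the representations
> P(u,t) = tan(tan⁻¹u + t) and Q(u,t) = sec(tan⁻¹u + t)/sec(tan⁻¹u)».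
> §3. «By setting u = 0 in equations (1) we see that Pₙ(0) and Qₙ(0) are respectively the tangent and
> secant numbers […]. Set u = 1 […] to get (5) Pₙ(1) = 2ⁿ(Pₙ(0) + Qₙ(0)) = 2ⁿQₙ(0), n even; 2ⁿPₙ(0), n odd.»
> «Theorem 3.1. For integers n ≥ 0, Qₙ(1) = −sin(nπ/2) + Σ_{2k≤n} binom(n,2k)(−1)ᵏ P_{n−2k}(1).»
> «3. The numbers Qₙ(1) were extensively studied by Glaisher [9,11]».
> §4. «1. If R is of type Aₙ, n ≥ 1, then M(R) = aₙ satisfies 1 + t + Σ_{n≥2} a_{n−1}tⁿ/n! = tan t + sec t.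
> 2. If R is of type Bₙ or Cₙ, n ≥ 2, then M(R) = bₙ satisfies 1 + t + Σ_{n≥2} bₙtⁿ/n! = (cos t + sin t)/cos 2t.
> 3. If R is of type Dₙ, n ≥ 3, then M(R) = dₙ satisfies t + t²/2 + Σ_{n≥3} dₙtⁿ/n! = (1 + sin 2t − cos t −
> sin t)/cos 2t. We shall call M(R) the Springer number of the root system R.
> Proposition 4.1. The Springer numbers aₙ, bₙ, and dₙ as defined above are given by aₙ = P_{n+1}(0) +
> Q_{n+1}(0), bₙ = Qₙ(1), and dₙ = Pₙ(1) − Qₙ(1). Proof. […] Q(1,t) = 1/(cos t − sin t) = (cos t + sin t)/cos 2t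
> and P(1,t) − Q(1,t) = (sin t + cos t − 1)/(cos t − sin t) = (1 + sin 2t − cos t − sin t)/cos 2t.»
> Proof of Theorem 4.2: «card β_{n+1} = Σ_{r=0}^{n} binom(n,r) card β_r card β_{n−r} + δ_{n0}, from which
> follows β′(t) = β(t)² + 1 […] β(t) = tan(t + π/4) = (tan t + 1)/(1 − tan t) = P(1,t)»;
> «card B_{n+1} = Σ_r binom(n,r) card B_r card β_{n−r} and we have b′(t) = b(t)β(t). Using b(0) = 1 and our
> formula for β(t), this gives b(t) = (1/√2) sec(t + π/4) = Q(1,t).» «equation (5) above implies card βₙ = 2ⁿa_{n−1}».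

Equation (1) is Theorem 3.1 of M. E. Hoffman, *Derivative polynomials for tangent and secant*, Amer. Math.
Monthly 102 (1995) 23–30 [Hoffman1995DerivativePolynomials] («[12]» above); the Springer numbers are from
T. A. Springer, *Remarks on a combinatorial problem*, Nieuw Arch. Wisk. 19 (1971) 30–36 [Springer1971Remarks]
and V. I. Arnol'd, Russian Math. Surveys 47 (1992) 1–51 [Arnold1992Snakes].

## What is formalized

* §0 formal calculus in `K⟦t⟧` for a field `K` of characteristic `0`: `(sin)′ = cos`, `(cos)′ = −sin`,
  `sin² + cos² = 1` (base change of the tree's `ℚ` versions), `(Dⁿf)(0) = n!·[tⁿ]f`, the product rule for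
  exponential generating functions, uniqueness for `w′ = wg` and for the linear system `y′ = az, z′ = −ay`,
  and the **formal double-angle formulas** `sin 2t = 2 sin t cos t`, `cos 2t = cos²t − sin²t`
  (`rescale_two_sin`, `rescale_two_cos`).
* §1 ★★★ **equation (1)** `egfP_eq : P(u,t) = (sin t + u cos t)(cos t − u sin t)⁻¹`,
  `egfQ_eq : Q(u,t) = (cos t − u sin t)⁻¹` for every `u ∈ K` — proved as in [12]/(3): the closed form `G`
  satisfies `∂G/∂t = 1 + G²`, hence `∂ⁿG/∂tⁿ = Pₙ(G)` by `P_{n+1} = (1 + X²)Pₙ′` (`iterate_derivative_closedP`),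
  and `n!·[tⁿ]G = Pₙ(G)(0) = Pₙ(u)`; likewise `∂ⁿF/∂tⁿ = Qₙ(G)F` for `F = (cos t − u sin t)⁻¹`.
* §2 `∂P/∂t = 1 + P²`, `∂Q/∂t = QP` and their coefficient forms ★ `aeval_P_succ`/`aeval_Q_succ`
  (`P_{n+1}(u) = δ_{n0} + Σ binom(n,k)Pₖ(u)P_{n−k}(u)`, `Q_{n+1}(u) = Σ binom(n,k)Qₖ(u)P_{n−k}(u)`), also as
  identities in `ℕ[X]` (`P_succ_eq_sum`, `Q_succ_eq_sum`); ★★ **Theorem 3.1 at general `u`**: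
  `u·Q(u,t) = cos t·P(u,t) − sin t` and `u·Qₙ(u) + sin(nπ/2) = Σ_{2k≤n} (−1)ᵏbinom(n,2k)P_{n−2k}(u)`.
* §3 `u = 0`: `P(0,t) = tan t`, `Q(0,t) = sec t`; `Pₙ(0) = Eₙ·[n odd]`, `Qₙ(0) = Eₙ·[n even]` for the tree's
  Euler zigzag numbers `eulerZigzag n = Eₙ`; ★ `Pₙ(0) + Qₙ(0) = Eₙ` (the André numbers; Proposition 4.1 `aₙ`).
* §4 `u = 1`: ★★ `egfP_one : P(1,t) = tan 2t + sec 2t` (Riccati uniqueness), ★★★ **(5) `Pₙ(1) = 2ⁿEₙ`**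
  (`eval_one_P`, and as printed `eval_one_P_eq`); `Q(1,t)(cos t − sin t) = 1`; ★ **Proposition 4.1**:
  `Q(1,t)·cos 2t = cos t + sin t` and `(P(1,t) − Q(1,t))·cos 2t = 1 + sin 2t − cos t − sin t`; ★★ the
  recurrence `Q_{n+1}(1) = Σ binom(n,k)Qₖ(1)·2^{n−k}E_{n−k}` of the Springer numbers `bₙ = Qₙ(1)` and
  `P_{n+1}(1) = δ_{n0} + Σ binom(n,k)Pₖ(1)P_{n−k}(1)`; ★★ **Theorem 3.1** (`eval_one_Q_eq`, in `ℤ`); the tables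
  `b₀..b₇ = 1, 1, 3, 11, 57, 361, 2763, 24611`, `Pₙ(1) = 1, 2, 4, 16, 80, 512, 3904`,
  `d₁..d₇ = 1, 1, 5, 23, 151, 1141, 10205`, and `Qₙ(1) ≤ Pₙ(1)`.
* §5 Theorem 2.1: positivity of the coefficients `q_{n,j}` (`n + j` even, `j ≤ n`; the tree has `p_pos`,
  the degrees and the vanishing pattern), and the parities `Pₙ(−u) = (−1)ⁿ⁺¹Pₙ(u)`, `Qₙ(−u) = (−1)ⁿQₙ(u)`.

MODEL.  `Pₙ(u)` for `u ∈ K` is Mathlib's `Polynomial.aeval u (TangentNumbers.P n)` (`ℕ`-algebra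
evaluation; `aeval_nat_eq`: the evaluation of the base-changed polynomial), and `Pₙ(1) ∈ ℕ` is
`(TangentNumbers.P n).eval 1`.  `sin 2t`, `cos 2t` are `rescale 2 sin`, `rescale 2 cos`.  Statements over `ℚ`
that meet the tree's `tanSeries`/`secSeries` are bridged from the general-`K` theorems with
`Subsingleton (Algebra ℚ ℚ)`.  The Springer numbers are typed through Proposition 4.1 (`bₙ = Qₙ(1)`,
`dₙ = Pₙ(1) − Qₙ(1)`, `a_{n−1} = Pₙ(0) + Qₙ(0) = Eₙ`) together with Springer's three generating functions;
Springer's own definition `M(R) = max_I σ(I,S)` over Weyl groups and Arnol'd's snakes (Theorems 4.2, 4.3)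
are NOT typed here (the snake counts are the subject of a separate file), nor are the composition relations
(3) as identities of two-variable series, the functional equation (4), Theorem 2.2, Theorem 2.3 (series of
reciprocal powers), Theorems 3.2–3.3 (values at `√3`), §5 (Shanks numbers) and §6 (Euler polynomials).
-/

namespace Literature.Combinatorics.Enumerative
namespace DerivativePolynomials

open PowerSeries Finset
open scoped Nat
open Literature.ComputerArithmetic.BrentZimmermann2010

/-! ### §0 Formal calculus over a field of characteristic zero -/

section Tools

variable {K : Type*} [Field K]

/-- `d(C u · f)/dt = C u · df/dt` (the derivation is `K`-linear). [cite: Hoffman1999DerivativePolynomials, §2 («From the chain rule it follows …»; the derivation `d/dt` is `K`-linear)] -/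
theorem derivative_C_mul (u : K) (f : K⟦X⟧) : d⁄dX K (C u * f) = C u * d⁄dX K f := by
  rw [Derivation.leibniz, derivative_C, smul_zero, add_zero, smul_eq_mul]

/-- `d f(at)/dt = a · f′(at)`, formally: the derivative of `rescale a f`. [cite: Hoffman1999DerivativePolynomials, §4 proof of Proposition 4.1 («cos 2t», «sin 2t»: the chain rule for `t ↦ 2t`)] -/
theorem derivative_rescale (a : K) (f : K⟦X⟧) :
    d⁄dX K (rescale a f) = C a * rescale a (d⁄dX K f) := by
  ext n
  rw [coeff_derivative, coeff_rescale, coeff_C_mul, coeff_rescale, coeff_derivative, pow_succ]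
  ring

/-- `(Dⁿ f)` has `k`-th coefficient `(k+n)!/k! · [t^{k+n}] f`. [cite: Hoffman1999DerivativePolynomials, §3 («the coefficients of tⁿ/n! in the Maclaurin series of tan t and sec t»)] -/
theorem coeff_iterate_derivative (f : K⟦X⟧) :
    ∀ n k : ℕ, coeff k ((⇑(d⁄dX K))^[n] f) = (Nat.descFactorial (k + n) n : K) * coeff (k + n) f
  | 0, k => by simp
  | n + 1, k => by
      rw [Function.iterate_succ_apply', coeff_derivative, coeff_iterate_derivative f n (k + 1),
        show k + 1 + n = k + (n + 1) by ring, Nat.descFactorial_succ,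
        show k + (n + 1) - n = k + 1 by omega, Nat.cast_mul]
      push_cast
      ring

/-- `(Dⁿ f)(0) = n! · [tⁿ] f` (Taylor's formula for formal power series). [cite: Hoffman1999DerivativePolynomials, §3 («the coefficients of tⁿ/n! in the Maclaurin series of tan t and sec t»)] -/
theorem constantCoeff_iterate_derivative (f : K⟦X⟧) (n : ℕ) :
    constantCoeff ((⇑(d⁄dX K))^[n] f) = (n ! : K) * coeff n f := by
  rw [← coeff_zero_eq_constantCoeff_apply, coeff_iterate_derivative, zero_add, Nat.descFactorial_self]

/-- The constant term of `q(G)` is `q(G(0))` (`constantCoeff` is a ring homomorphism fixing `K`).  A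
private copy of the tree's `Literature.NumberTheory.LFunctions.constantCoeff_aeval`
(`BernoulliGammaTransformIdentity.lean`), whose Dirichlet-character import cone is not wanted here. [folklore] -/
private theorem constantCoeff_aeval (G : K⟦X⟧) (q : Polynomial K) :
    constantCoeff (Polynomial.aeval G q) = q.eval (constantCoeff G) := by
  rw [Polynomial.aeval_def, Polynomial.hom_eval₂, ← Polynomial.eval_map]
  congr 1
  conv_rhs => rw [← Polynomial.map_id (p := q)]
  congr 1

/-- `P(u)` for `P ∈ ℕ[X]` and `u ∈ K`: Mathlib's `aeval` over `ℕ` is evaluation of the base-changed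
polynomial `P ↦ P.map (ℕ → K)`. [cite: Hoffman1999DerivativePolynomials, §1 («P_n(u)»: the value of Pₙ ∈ ℤ[u] at u)] -/
theorem aeval_nat_eq (u : K) (p : Polynomial ℕ) :
    Polynomial.aeval u p = (p.map (Nat.castRingHom K)).eval u := by
  rw [Polynomial.eval_map, Polynomial.aeval_def]
  rfl

/-- At `u = 1`: `P(1) ∈ ℕ` cast into `K`. [cite: Hoffman1999DerivativePolynomials, §3 eq. (5) («P_n(1)»)] -/
theorem aeval_one_nat (p : Polynomial ℕ) : Polynomial.aeval (1 : K) p = ((p.eval 1 : ℕ) : K) := by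
  rw [aeval_nat_eq, Polynomial.eval_map, Polynomial.eval₂_at_one, Nat.coe_castRingHom]

/-- At `u = 0`: `P(0) = ` the constant coefficient. [cite: Hoffman1999DerivativePolynomials, §3 («P_n(0) and Q_n(0)»)] -/
theorem aeval_zero_nat (p : Polynomial ℕ) : Polynomial.aeval (0 : K) p = ((p.coeff 0 : ℕ) : K) := by
  rw [aeval_nat_eq, Polynomial.eval_map, Polynomial.eval₂_at_zero, Nat.coe_castRingHom]

/-- Sums over the even indices `0, 2, …, ≤ n`, re-indexed by `j = 2k`. [cite: Hoffman1999DerivativePolynomials, §3 Theorem 3.1 («Σ_{2k≤n}»: re-indexing the even terms)] -/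
theorem sum_range_succ_even (f : ℕ → K) (n : ℕ) :
    ∑ j ∈ range (n + 1), (if Even j then f j else 0) = ∑ k ∈ range (n / 2 + 1), f (2 * k) := by
  rw [← sum_filter]
  have h : (range (n + 1)).filter Even = (range (n / 2 + 1)).image (2 * ·) := by
    ext j
    simp only [mem_filter, mem_range, mem_image, Nat.even_iff]
    constructor
    · intro hj; exact ⟨j / 2, by omega, by omega⟩
    · rintro ⟨a, ha, rfl⟩; omega
  rw [h, sum_image fun a _ b _ hab => by simpa using hab]

variable [CharZero K]

/-- `d/dt` commutes with the base change `ℚ⟦t⟧ → K⟦t⟧`. [cite: Hoffman1999DerivativePolynomials, §1 eq. (1) (base change of the series identities from ℚ to K)] -/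
theorem derivative_map (f : ℚ⟦X⟧) :
    d⁄dX K (map (algebraMap ℚ K) f) = map (algebraMap ℚ K) (d⁄dX ℚ f) := by
  ext n
  simp [coeff_derivative, coeff_map]

/-- Constant terms commute with the base change `ℚ⟦t⟧ → K⟦t⟧`. [cite: Hoffman1999DerivativePolynomials, §1 eq. (1) (base change of the series identities from ℚ to K)] -/
theorem constantCoeff_map' (f : ℚ⟦X⟧) :
    constantCoeff (map (algebraMap ℚ K) f) = algebraMap ℚ K (constantCoeff f) := by
  rw [← coeff_zero_eq_constantCoeff_apply, coeff_map, coeff_zero_eq_constantCoeff_apply]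

/-- `(sin t)′ = cos t` in `K⟦t⟧` (base change of the tree's `derivative_sin` over `ℚ`).
[cite: Hoffman1999DerivativePolynomials, §2 («From the chain rule it follows …»)] -/
theorem derivative_sin_eq : d⁄dX K (PowerSeries.sin K) = PowerSeries.cos K := by
  rw [← map_sin (algebraMap ℚ K), derivative_map, derivative_sin, map_cos]

/-- `(cos t)′ = −sin t` in `K⟦t⟧`. [cite: Hoffman1999DerivativePolynomials, §2 («From the chain rule it follows …»)] -/
theorem derivative_cos_eq : d⁄dX K (PowerSeries.cos K) = -PowerSeries.sin K := by
  rw [← map_cos (algebraMap ℚ K), derivative_map, derivative_cos, map_neg, map_sin]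

/-- `sin² t + cos² t = 1` in `K⟦t⟧`. [cite: Hoffman1999DerivativePolynomials, §3 proof of Theorem 3.1 (the trigonometric identity behind «u·Q = cos·P − sin»)] -/
theorem sin_sq_add_cos_sq_eq : PowerSeries.sin K ^ 2 + PowerSeries.cos K ^ 2 = 1 := by
  have h := congrArg (map (algebraMap ℚ K)) sin_sq_add_cos_sq
  rwa [map_add, map_pow, map_pow, map_sin, map_cos, map_one] at h

/-- `cos 0 = 1`. [cite: Hoffman1999DerivativePolynomials, §1 eq. (1) («cos t − u sin t» has constant term 1)] -/
theorem constantCoeff_cos_eq : constantCoeff (PowerSeries.cos K) = 1 := by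
  rw [← map_cos (algebraMap ℚ K), constantCoeff_map', constantCoeff_cos, map_one]

/-- `sin 0 = 0`. [cite: Hoffman1999DerivativePolynomials, §1 eq. (1) («sin t + u cos t» has constant term u)] -/
theorem constantCoeff_sin_eq : constantCoeff (PowerSeries.sin K) = 0 := by
  rw [← map_sin (algebraMap ℚ K), constantCoeff_map', constantCoeff_sin, map_zero]

/-- The coefficients of `cos t`: `(−1)^{j/2}/j!` at even `j`, `0` at odd `j`. [cite: Hoffman1999DerivativePolynomials, §3 Theorem 3.1 («binom(n,2k)(−1)^k»: the Maclaurin coefficients of cos t)] -/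
theorem coeff_cos_eq (j : ℕ) :
    coeff j (PowerSeries.cos K) = (if Even j then (-1 : K) ^ (j / 2) else 0) / (j ! : K) := by
  simp only [PowerSeries.cos, coeff_mk]
  split_ifs with h
  · rw [map_div₀, map_pow, map_neg, map_one, map_natCast]
  · rw [zero_div]

/-- The coefficients of `sin t`: `0` at even `j`, `(−1)^{(j−1)/2}/j!` at odd `j`. [cite: Hoffman1999DerivativePolynomials, §3 Theorem 3.1 («−sin(nπ/2)»: the Maclaurin coefficients of sin t times n!)] -/
theorem coeff_sin_eq (j : ℕ) :
    coeff j (PowerSeries.sin K) = (if Even j then 0 else (-1 : K) ^ (j / 2)) / (j ! : K) := by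
  simp only [PowerSeries.sin, coeff_mk]
  split_ifs with h
  · rw [zero_div]
  · rw [map_div₀, map_pow, map_neg, map_one, map_natCast]

/-- `cos t` as an exponential generating function. [cite: Hoffman1999DerivativePolynomials, §3 Theorem 3.1 (the Maclaurin coefficients of cos t)] -/
theorem cos_eq_mk : PowerSeries.cos K = mk fun j => (if Even j then (-1 : K) ^ (j / 2) else 0) / (j ! : K) := by
  ext j; rw [coeff_cos_eq, coeff_mk]

/-- Coefficients of a product of two exponential generating functions:
`[tⁿ] (Σ fⱼtʲ/j!)(Σ gⱼtʲ/j!) = (Σⱼ binom(n,j) fⱼ g_{n−j})/n!`. [cite: Hoffman1999DerivativePolynomials, §2 proof of Theorem 2.2 («Take the coefficient of tⁿ/n!»)] -/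
theorem coeff_egf_mul (f g : ℕ → K) (n : ℕ) :
    coeff n ((mk fun j => f j / (j ! : K)) * mk fun j => g j / (j ! : K)) =
      (∑ j ∈ range (n + 1), (n.choose j : K) * f j * g (n - j)) / (n ! : K) := by
  rw [coeff_mul, Nat.sum_antidiagonal_eq_sum_range_succ_mk, sum_div]
  refine sum_congr rfl fun j hj => ?_
  have hj' : j ≤ n := Nat.lt_succ_iff.1 (mem_range.1 hj)
  rw [coeff_mk, coeff_mk, Nat.cast_choose K hj']
  have h1 : (j ! : K) ≠ 0 := Nat.cast_ne_zero.2 (Nat.factorial_ne_zero _)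
  have h2 : ((n - j)! : K) ≠ 0 := Nat.cast_ne_zero.2 (Nat.factorial_ne_zero _)
  have h3 : (n ! : K) ≠ 0 := Nat.cast_ne_zero.2 (Nat.factorial_ne_zero _)
  field_simp

/-- Uniqueness for `w′ = w·g`: a solution with `w(0) = 0` vanishes (characteristic zero). [cite: Hoffman1999DerivativePolynomials, §4 proof of Theorem 4.2 («The unique solution of this differential equation satisfying the initial condition»)] -/
theorem eq_zero_of_derivative_eq_mul {w g : K⟦X⟧} (hw : d⁄dX K w = w * g)
    (h0 : constantCoeff w = 0) : w = 0 := by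
  suffices h : ∀ n, ∀ m ≤ n, coeff m w = 0 by
    ext m; rw [h m m le_rfl, map_zero]
  intro n
  induction n with
  | zero => intro m hm; rw [Nat.le_zero.1 hm, coeff_zero_eq_constantCoeff_apply, h0]
  | succ n ih =>
      intro m hm
      rcases Nat.lt_or_ge m (n + 1) with hlt | hge
      · exact ih m (by omega)
      · obtain rfl : m = n + 1 := le_antisymm hm hge
        have h := PowerSeries.ext_iff.1 hw n
        rw [coeff_derivative, coeff_mul] at h
        have hs : ∑ p ∈ antidiagonal n, coeff p.1 w * coeff p.2 g = 0 :=
          sum_eq_zero fun p hp => by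
            rw [ih p.1 (by have := mem_antidiagonal.1 hp; omega), zero_mul]
        rw [hs] at h
        exact (mul_eq_zero.1 h).resolve_right (Nat.cast_add_one_ne_zero n)

/-- Uniqueness for the linear system `y′ = a z`, `z′ = −a y` with `y(0) = z(0) = 0`: only the zero
solution (characteristic zero). [cite: Hoffman1999DerivativePolynomials, §4 proof of Proposition 4.1 («cos 2t», «sin 2t»; uniqueness of the solution of the defining system)] -/
theorem eq_zero_of_linear_system {y z : K⟦X⟧} (a : K) (hy : d⁄dX K y = C a * z)
    (hz : d⁄dX K z = -(C a * y)) (hy0 : constantCoeff y = 0) (hz0 : constantCoeff z = 0) :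
    y = 0 ∧ z = 0 := by
  suffices h : ∀ n, coeff n y = 0 ∧ coeff n z = 0 by
    constructor <;> ext n
    · rw [(h n).1, map_zero]
    · rw [(h n).2, map_zero]
  intro n
  induction n with
  | zero => exact ⟨by rw [coeff_zero_eq_constantCoeff_apply, hy0],
      by rw [coeff_zero_eq_constantCoeff_apply, hz0]⟩
  | succ n ih =>
      have h1 := PowerSeries.ext_iff.1 hy n
      have h2 := PowerSeries.ext_iff.1 hz n
      rw [coeff_derivative, coeff_C_mul, ih.2, mul_zero] at h1
      rw [coeff_derivative, map_neg, coeff_C_mul, ih.1, mul_zero, neg_zero] at h2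
      exact ⟨(mul_eq_zero.1 h1).resolve_right (Nat.cast_add_one_ne_zero n),
        (mul_eq_zero.1 h2).resolve_right (Nat.cast_add_one_ne_zero n)⟩

/-- **Formal double-angle formulas**: `sin 2t = 2 sin t cos t` in `K⟦t⟧` (`sin 2t = rescale 2 sin`).
[cite: Hoffman1999DerivativePolynomials, §4 Proposition 4.1 proof («cos 2t», «sin 2t»)] -/
theorem rescale_two_sin : rescale 2 (PowerSeries.sin K) = 2 * PowerSeries.sin K * PowerSeries.cos K := by
  have h := eq_zero_of_linear_system (K := K) (y := rescale 2 (PowerSeries.sin K) -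
      2 * PowerSeries.sin K * PowerSeries.cos K)
    (z := rescale 2 (PowerSeries.cos K) - (PowerSeries.cos K ^ 2 - PowerSeries.sin K ^ 2)) 2
    (by
      have h2 : d⁄dX K (2 : K⟦X⟧) = 0 := by
        rw [show (2 : K⟦X⟧) = C (2 : K) from (map_ofNat C 2).symm, derivative_C]
      rw [map_sub, derivative_rescale, derivative_sin_eq, Derivation.leibniz, Derivation.leibniz,
        derivative_sin_eq, derivative_cos_eq, h2, map_ofNat C]
      simp only [smul_eq_mul]
      ring)
    (by
      rw [map_sub, derivative_rescale, derivative_cos_eq, map_neg, map_sub, Derivation.leibniz_pow,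
        Derivation.leibniz_pow, derivative_sin_eq, derivative_cos_eq, map_ofNat C]
      simp only [smul_eq_mul, nsmul_eq_mul]
      push_cast
      ring)
    (by
      rw [map_sub, ← coeff_zero_eq_constantCoeff_apply, coeff_rescale, pow_zero, one_mul,
        coeff_zero_eq_constantCoeff_apply, map_mul, map_mul, constantCoeff_sin_eq]
      ring)
    (by
      rw [map_sub, ← coeff_zero_eq_constantCoeff_apply, coeff_rescale, pow_zero, one_mul,
        coeff_zero_eq_constantCoeff_apply, map_sub, map_pow, map_pow, constantCoeff_sin_eq,
        constantCoeff_cos_eq]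
      ring)
  exact sub_eq_zero.1 h.1

/-- `cos 2t = cos² t − sin² t` in `K⟦t⟧`. [cite: Hoffman1999DerivativePolynomials, §4 Proposition 4.1 proof («cos 2t»)] -/
theorem rescale_two_cos :
    rescale 2 (PowerSeries.cos K) = PowerSeries.cos K ^ 2 - PowerSeries.sin K ^ 2 := by
  have h := eq_zero_of_linear_system (K := K) (y := rescale 2 (PowerSeries.sin K) -
      2 * PowerSeries.sin K * PowerSeries.cos K)
    (z := rescale 2 (PowerSeries.cos K) - (PowerSeries.cos K ^ 2 - PowerSeries.sin K ^ 2)) 2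
    (by
      have h2 : d⁄dX K (2 : K⟦X⟧) = 0 := by
        rw [show (2 : K⟦X⟧) = C (2 : K) from (map_ofNat C 2).symm, derivative_C]
      rw [map_sub, derivative_rescale, derivative_sin_eq, Derivation.leibniz, Derivation.leibniz,
        derivative_sin_eq, derivative_cos_eq, h2, map_ofNat C]
      simp only [smul_eq_mul]
      ring)
    (by
      rw [map_sub, derivative_rescale, derivative_cos_eq, map_neg, map_sub, Derivation.leibniz_pow,
        Derivation.leibniz_pow, derivative_sin_eq, derivative_cos_eq, map_ofNat C]
      simp only [smul_eq_mul, nsmul_eq_mul]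
      push_cast
      ring)
    (by
      rw [map_sub, ← coeff_zero_eq_constantCoeff_apply, coeff_rescale, pow_zero, one_mul,
        coeff_zero_eq_constantCoeff_apply, map_mul, map_mul, constantCoeff_sin_eq]
      ring)
    (by
      rw [map_sub, ← coeff_zero_eq_constantCoeff_apply, coeff_rescale, pow_zero, one_mul,
        coeff_zero_eq_constantCoeff_apply, map_sub, map_pow, map_pow, constantCoeff_sin_eq,
        constantCoeff_cos_eq]
      ring)
  exact sub_eq_zero.1 h.2

end Tools

/-! ### §1 The exponential generating functions `P(u,t)`, `Q(u,t)` and their closed forms (1) -/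

section EGF

variable {K : Type*} [Field K]

/-- **`P(u,t) = Σₙ Pₙ(u) tⁿ/n!`**, the exponential generating function of the derivative polynomials of
the tangent (`dⁿ/dxⁿ tan x = Pₙ(tan x)`; the tree's `TangentNumbers.P n ∈ ℕ[X]`), at a point `u` of a
field `K ⊇ ℚ`, as a formal power series in `t`.
[cite: Hoffman1999DerivativePolynomials, §1 («P(u,t) = Σ_{n=0}^∞ P_n(u) tⁿ/n!»)] -/
noncomputable def egfP (u : K) : K⟦X⟧ :=
  PowerSeries.mk fun n => Polynomial.aeval u (TangentNumbers.P n) / (n ! : K)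

/-- **`Q(u,t) = Σₙ Qₙ(u) tⁿ/n!`**, the exponential generating function of the derivative polynomials of
the secant (`dⁿ/dxⁿ sec x = Qₙ(tan x) sec x`; the tree's `TangentNumbers.Q n ∈ ℕ[X]`).
[cite: Hoffman1999DerivativePolynomials, §1 («Q(u,t) = Σ_{n=0}^∞ Q_n(u) tⁿ/n!»)] -/
noncomputable def egfQ (u : K) : K⟦X⟧ :=
  PowerSeries.mk fun n => Polynomial.aeval u (TangentNumbers.Q n) / (n ! : K)

/-- `[tⁿ] P(u,t) = Pₙ(u)/n!`. [cite: Hoffman1999DerivativePolynomials, §1 (definition of P(u,t))] -/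
@[simp] theorem coeff_egfP (u : K) (n : ℕ) :
    coeff n (egfP u) = Polynomial.aeval u (TangentNumbers.P n) / (n ! : K) := by
  rw [egfP, coeff_mk]

/-- `[tⁿ] Q(u,t) = Qₙ(u)/n!`. [cite: Hoffman1999DerivativePolynomials, §1 (definition of Q(u,t))] -/
@[simp] theorem coeff_egfQ (u : K) (n : ℕ) :
    coeff n (egfQ u) = Polynomial.aeval u (TangentNumbers.Q n) / (n ! : K) := by
  rw [egfQ, coeff_mk]

variable [CharZero K]

/-- The denominator `cos t − u sin t` has constant term `1` … [cite: Hoffman1999DerivativePolynomials, §1 eq. (1)] -/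
theorem constantCoeff_den (u : K) :
    constantCoeff (PowerSeries.cos K - C u * PowerSeries.sin K) = 1 := by
  rw [map_sub, map_mul, constantCoeff_cos_eq, constantCoeff_sin_eq, mul_zero, sub_zero]

/-- … hence is invertible in `K⟦t⟧`. [cite: Hoffman1999DerivativePolynomials, §1 eq. (1)] -/
theorem den_mul_inv (u : K) :
    (PowerSeries.cos K - C u * PowerSeries.sin K) * (PowerSeries.cos K - C u * PowerSeries.sin K)⁻¹ = 1 :=
  PowerSeries.mul_inv_cancel _ (by rw [constantCoeff_den]; exact one_ne_zero)

/-- The numerator `sin t + u cos t` has constant term `u`. [cite: Hoffman1999DerivativePolynomials, §1 eq. (1)] -/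
theorem constantCoeff_num (u : K) :
    constantCoeff (PowerSeries.sin K + C u * PowerSeries.cos K) = u := by
  rw [map_add, map_mul, constantCoeff_cos_eq, constantCoeff_sin_eq, constantCoeff_C, mul_one, zero_add]

/-- `(sin t + u cos t)′ = cos t − u sin t`. [cite: Hoffman1999DerivativePolynomials, §1 eq. (1)] -/
theorem derivative_num (u : K) :
    d⁄dX K (PowerSeries.sin K + C u * PowerSeries.cos K) =
      PowerSeries.cos K - C u * PowerSeries.sin K := by
  rw [map_add, derivative_C_mul, derivative_sin_eq, derivative_cos_eq, mul_neg, sub_eq_add_neg]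

/-- `(cos t − u sin t)′ = −(sin t + u cos t)`. [cite: Hoffman1999DerivativePolynomials, §1 eq. (1)] -/
theorem derivative_den (u : K) :
    d⁄dX K (PowerSeries.cos K - C u * PowerSeries.sin K) =
      -(PowerSeries.sin K + C u * PowerSeries.cos K) := by
  rw [map_sub, derivative_C_mul, derivative_sin_eq, derivative_cos_eq, neg_add']

/-- The closed form `G = (sin t + u cos t)/(cos t − u sin t)` (`= tan(t + tan⁻¹ u)`) satisfies the
Riccati equation `∂G/∂t = 1 + G²`.
[cite: Hoffman1999DerivativePolynomials, §2 eq. (3) and «P(u,t) = tan(tan⁻¹ u + t)»] -/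
theorem derivative_closedP (u : K) :
    d⁄dX K ((PowerSeries.sin K + C u * PowerSeries.cos K) *
        (PowerSeries.cos K - C u * PowerSeries.sin K)⁻¹) =
      1 + ((PowerSeries.sin K + C u * PowerSeries.cos K) *
        (PowerSeries.cos K - C u * PowerSeries.sin K)⁻¹) ^ 2 := by
  set N := PowerSeries.sin K + C u * PowerSeries.cos K with hN
  set D := PowerSeries.cos K - C u * PowerSeries.sin K with hD
  have hDD : D * D⁻¹ = 1 := den_mul_inv u
  rw [Derivation.leibniz, derivative_inv', smul_eq_mul, smul_eq_mul, derivative_num, derivative_den,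
    ← hD, ← hN]
  calc N * (-D⁻¹ ^ 2 * -N) + D⁻¹ * D = (N * D⁻¹) ^ 2 + D * D⁻¹ := by ring
    _ = 1 + (N * D⁻¹) ^ 2 := by rw [hDD, add_comm]

/-- The closed form `F = 1/(cos t − u sin t)` (`= sec(t + tan⁻¹ u)/sec(tan⁻¹ u)`) satisfies `∂F/∂t = F·G`.
[cite: Hoffman1999DerivativePolynomials, §2 eq. (3) and «Q(u,t) = sec(tan⁻¹ u + t)/sec(tan⁻¹ u)»] -/
theorem derivative_closedQ (u : K) :
    d⁄dX K (PowerSeries.cos K - C u * PowerSeries.sin K)⁻¹ =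
      (PowerSeries.cos K - C u * PowerSeries.sin K)⁻¹ *
        ((PowerSeries.sin K + C u * PowerSeries.cos K) *
          (PowerSeries.cos K - C u * PowerSeries.sin K)⁻¹) := by
  rw [derivative_inv', derivative_den]
  ring

/-- `∂ⁿG/∂tⁿ = Pₙ(G)` for the closed form `G` — the formal counterpart of `dⁿ tan x/dxⁿ = Pₙ(tan x)`
along `t ↦ tan(t + tan⁻¹ u)`, by the chain rule `Pₙ₊₁ = (1 + X²)Pₙ′`.
[cite: Hoffman1999DerivativePolynomials, §2 («P₀(u) = u and P_{n+1}(u) = (u² + 1)P_n′(u)»)] -/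
theorem iterate_derivative_closedP (u : K) : ∀ n : ℕ,
    (⇑(d⁄dX K))^[n] ((PowerSeries.sin K + C u * PowerSeries.cos K) *
        (PowerSeries.cos K - C u * PowerSeries.sin K)⁻¹) =
      Polynomial.aeval ((PowerSeries.sin K + C u * PowerSeries.cos K) *
        (PowerSeries.cos K - C u * PowerSeries.sin K)⁻¹)
        ((TangentNumbers.P n).map (Nat.castRingHom K))
  | 0 => by simp [TangentNumbers.P_zero]
  | n + 1 => by
      rw [Function.iterate_succ_apply', iterate_derivative_closedP u n, Derivation.map_aeval,
        derivative_closedP, smul_eq_mul, TangentNumbers.P_succ, Polynomial.map_mul,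
        ← Polynomial.derivative_map, map_mul, Polynomial.map_add, Polynomial.map_one, Polynomial.map_pow,
        Polynomial.map_X, map_add, map_one, map_pow, Polynomial.aeval_X, mul_comm]

/-- `∂ⁿF/∂tⁿ = Qₙ(G)·F` for the closed forms — the formal counterpart of `dⁿ sec x/dxⁿ = Qₙ(tan x) sec x`,
by `Qₙ₊₁ = (1 + X²)Qₙ′ + X Qₙ`.
[cite: Hoffman1999DerivativePolynomials, §2 («Q₀(u) = 1 and Q_{n+1}(u) = (u² + 1)Q_n′(u) + uQ_n(u)»)] -/
theorem iterate_derivative_closedQ (u : K) : ∀ n : ℕ,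
    (⇑(d⁄dX K))^[n] (PowerSeries.cos K - C u * PowerSeries.sin K)⁻¹ =
      (PowerSeries.cos K - C u * PowerSeries.sin K)⁻¹ *
      Polynomial.aeval ((PowerSeries.sin K + C u * PowerSeries.cos K) *
        (PowerSeries.cos K - C u * PowerSeries.sin K)⁻¹)
        ((TangentNumbers.Q n).map (Nat.castRingHom K))
  | 0 => by simp [TangentNumbers.Q]
  | n + 1 => by
      rw [Function.iterate_succ_apply', iterate_derivative_closedQ u n, Derivation.leibniz,
        Derivation.map_aeval, derivative_closedP, derivative_closedQ, smul_eq_mul, smul_eq_mul,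
        smul_eq_mul, TangentNumbers.Q, Polynomial.map_add, Polynomial.map_mul, Polynomial.map_mul,
        ← Polynomial.derivative_map, Polynomial.map_X, Polynomial.map_add, Polynomial.map_one,
        Polynomial.map_pow, Polynomial.map_X, map_add, map_mul, map_mul, map_add, map_one, map_pow,
        Polynomial.aeval_X]
      ring

/-- The constant term of the closed form `G` is `u` (`tan(tan⁻¹ u) = u`). [cite: Hoffman1999DerivativePolynomials, §2 («P₀(u) = u»)] -/
theorem constantCoeff_closedP (u : K) :
    constantCoeff ((PowerSeries.sin K + C u * PowerSeries.cos K) *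
        (PowerSeries.cos K - C u * PowerSeries.sin K)⁻¹) = u := by
  rw [map_mul, constantCoeff_inv, constantCoeff_num, constantCoeff_den, inv_one, mul_one]

/-- ★★★ **Hoffman's closed form (1) for the tangent**: `P(u,t) = Σ Pₙ(u)tⁿ/n! = (sin t + u cos t)/(cos t − u sin t)`
in `K⟦t⟧`, for every `u` in a field `K` of characteristic `0`.
[cite: Hoffman1999DerivativePolynomials, §1 eq. (1) («P(u,t) = (sin t + u cos t)/(cos t − u sin t)»); Hoffman1995DerivativePolynomials, Theorem 3.1] -/
theorem egfP_eq (u : K) :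
    egfP u = (PowerSeries.sin K + C u * PowerSeries.cos K) *
      (PowerSeries.cos K - C u * PowerSeries.sin K)⁻¹ := by
  ext n
  have h := constantCoeff_iterate_derivative ((PowerSeries.sin K + C u * PowerSeries.cos K) *
      (PowerSeries.cos K - C u * PowerSeries.sin K)⁻¹) n
  rw [iterate_derivative_closedP, constantCoeff_aeval, constantCoeff_closedP, ← aeval_nat_eq] at h
  rw [coeff_egfP, h, mul_div_cancel_left₀ _ (Nat.cast_ne_zero.2 (Nat.factorial_ne_zero n))]

/-- ★★★ **Hoffman's closed form (1) for the secant**: `Q(u,t) = Σ Qₙ(u)tⁿ/n! = 1/(cos t − u sin t)`.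
[cite: Hoffman1999DerivativePolynomials, §1 eq. (1) («Q(u,t) = 1/(cos t − u sin t)»); Hoffman1995DerivativePolynomials, Theorem 3.1] -/
theorem egfQ_eq (u : K) : egfQ u = (PowerSeries.cos K - C u * PowerSeries.sin K)⁻¹ := by
  ext n
  have h := constantCoeff_iterate_derivative (PowerSeries.cos K - C u * PowerSeries.sin K)⁻¹ n
  rw [iterate_derivative_closedQ, map_mul, constantCoeff_aeval, constantCoeff_closedP, ← aeval_nat_eq,
    constantCoeff_inv, constantCoeff_den, inv_one, one_mul] at h
  rw [coeff_egfQ, h, mul_div_cancel_left₀ _ (Nat.cast_ne_zero.2 (Nat.factorial_ne_zero n))]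

/-- (1) with the denominator cleared: `P(u,t)·(cos t − u sin t) = sin t + u cos t`.
[cite: Hoffman1999DerivativePolynomials, §1 eq. (1)] -/
theorem egfP_mul_den (u : K) :
    egfP u * (PowerSeries.cos K - C u * PowerSeries.sin K) =
      PowerSeries.sin K + C u * PowerSeries.cos K := by
  rw [egfP_eq, mul_assoc, PowerSeries.inv_mul_cancel _ (by rw [constantCoeff_den]; exact one_ne_zero),
    mul_one]

/-- (1) with the denominator cleared: `Q(u,t)·(cos t − u sin t) = 1`.
[cite: Hoffman1999DerivativePolynomials, §1 eq. (1)] -/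
theorem egfQ_mul_den (u : K) : egfQ u * (PowerSeries.cos K - C u * PowerSeries.sin K) = 1 := by
  rw [egfQ_eq, PowerSeries.inv_mul_cancel _ (by rw [constantCoeff_den]; exact one_ne_zero)]

/-- `P(u,0) = P₀(u) = u`. [cite: Hoffman1999DerivativePolynomials, §2 («P₀(u) = u»)] -/
theorem constantCoeff_egfP (u : K) : constantCoeff (egfP u) = u := by
  rw [egfP_eq, constantCoeff_closedP]

/-- `Q(u,0) = Q₀(u) = 1`. [cite: Hoffman1999DerivativePolynomials, §2 («Q₀(u) = 1»)] -/
theorem constantCoeff_egfQ (u : K) : constantCoeff (egfQ u) = 1 := by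
  rw [egfQ_eq, constantCoeff_inv, constantCoeff_den, inv_one]

/-! ### §2 The differential equations in `t` and the convolution recurrences -/

/-- `∂P/∂t = 1 + P²` (`P(u,t) = tan(t + tan⁻¹u)`; the infinitesimal form of the composition relation
`P(P(u,t),s) = P(u,t+s)`). [cite: Hoffman1999DerivativePolynomials, §2 eq. (3) and §4 proof of Theorem 4.2 («β′(t) = β(t)² + 1»)] -/
theorem derivative_egfP (u : K) : d⁄dX K (egfP u) = 1 + egfP u ^ 2 := by
  rw [egfP_eq]; exact derivative_closedP u

/-- `∂Q/∂t = Q·P` (the infinitesimal form of `Q(P(u,t),s)Q(u,t) = Q(u,t+s)`).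
[cite: Hoffman1999DerivativePolynomials, §2 eq. (3) and §4 proof of Theorem 4.2 («b′(t) = b(t)β(t)»)] -/
theorem derivative_egfQ (u : K) : d⁄dX K (egfQ u) = egfQ u * egfP u := by
  rw [egfQ_eq, egfP_eq]; exact derivative_closedQ u

/-- ★ **Convolution recurrence for the `Pₙ`**: `Pₙ₊₁(u) = δ_{n0} + Σₖ binom(n,k) Pₖ(u) P_{n−k}(u)`, the
coefficient form of `∂P/∂t = 1 + P²`.
[cite: Hoffman1999DerivativePolynomials, §4 proof of Theorem 4.2 («card β_{n+1} = Σ binom(n,r) card β_r card β_{n−r} + δ_{n0}», «β′(t) = β(t)² + 1»)] -/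
theorem aeval_P_succ (u : K) (n : ℕ) :
    Polynomial.aeval u (TangentNumbers.P (n + 1)) =
      (if n = 0 then 1 else 0) + ∑ k ∈ range (n + 1), (n.choose k : K) *
        Polynomial.aeval u (TangentNumbers.P k) * Polynomial.aeval u (TangentNumbers.P (n - k)) := by
  have h := PowerSeries.ext_iff.1 (derivative_egfP u) n
  rw [coeff_derivative, coeff_egfP, map_add, coeff_one, pow_two, egfP, coeff_egf_mul] at h
  have hn : (n ! : K) ≠ 0 := Nat.cast_ne_zero.2 (Nat.factorial_ne_zero n)
  have e1 : Polynomial.aeval u (TangentNumbers.P (n + 1)) / ((n + 1)! : K) * ((n : K) + 1) =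
      Polynomial.aeval u (TangentNumbers.P (n + 1)) / (n ! : K) := by
    rw [Nat.factorial_succ, Nat.cast_mul, Nat.cast_succ]
    field_simp
  rw [e1, div_eq_iff hn] at h
  rw [h, add_mul, div_mul_cancel₀ _ hn]
  congr 1
  split_ifs with h0 <;> simp [h0]

/-- ★ **Convolution recurrence for the `Qₙ`**: `Qₙ₊₁(u) = Σₖ binom(n,k) Qₖ(u) P_{n−k}(u)`, the coefficient
form of `∂Q/∂t = QP`.
[cite: Hoffman1999DerivativePolynomials, §4 proof of Theorem 4.2 («card B_{n+1} = Σ binom(n,r) card B_r card β_{n−r}», «b′(t) = b(t)β(t)»)] -/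
theorem aeval_Q_succ (u : K) (n : ℕ) :
    Polynomial.aeval u (TangentNumbers.Q (n + 1)) =
      ∑ k ∈ range (n + 1), (n.choose k : K) *
        Polynomial.aeval u (TangentNumbers.Q k) * Polynomial.aeval u (TangentNumbers.P (n - k)) := by
  have h := PowerSeries.ext_iff.1 (derivative_egfQ u) n
  rw [coeff_derivative, coeff_egfQ, egfQ, egfP, coeff_egf_mul] at h
  have hn : (n ! : K) ≠ 0 := Nat.cast_ne_zero.2 (Nat.factorial_ne_zero n)
  have e1 : Polynomial.aeval u (TangentNumbers.Q (n + 1)) / ((n + 1)! : K) * ((n : K) + 1) =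
      Polynomial.aeval u (TangentNumbers.Q (n + 1)) / (n ! : K) := by
    rw [Nat.factorial_succ, Nat.cast_mul, Nat.cast_succ]
    field_simp
  rw [e1, div_eq_iff hn, div_mul_cancel₀ _ hn] at h
  exact h

/-- ★ **The convolution recurrence in `ℕ[X]`**: `Pₙ₊₁ = δ_{n0} + Σₖ binom(n,k)·PₖP_{n−k}` (two polynomials
over `ℕ` agreeing at every rational argument are equal).
[cite: Hoffman1999DerivativePolynomials, §2 eq. (3) (coefficient of `s¹tⁿ/n!` in `P(P(u,t),s) = P(u,t+s)`)] -/
theorem P_succ_eq_sum (n : ℕ) :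
    TangentNumbers.P (n + 1) = (if n = 0 then 1 else 0) +
      ∑ k ∈ range (n + 1), n.choose k • (TangentNumbers.P k * TangentNumbers.P (n - k)) := by
  apply Polynomial.map_injective (Nat.castRingHom ℚ) Nat.cast_injective
  apply Polynomial.funext
  intro u
  rw [← aeval_nat_eq, aeval_P_succ, Polynomial.map_add, Polynomial.map_sum, Polynomial.eval_add,
    Polynomial.eval_finsetSum]
  congr 1
  · split_ifs <;> simp
  · refine sum_congr rfl fun k _ => ?_
    rw [nsmul_eq_mul, Polynomial.map_mul, Polynomial.map_mul, Polynomial.map_natCast, Polynomial.eval_mul,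
      Polynomial.eval_mul, Polynomial.eval_natCast, ← aeval_nat_eq, ← aeval_nat_eq, mul_assoc]

/-- ★ **The convolution recurrence in `ℕ[X]`**: `Qₙ₊₁ = Σₖ binom(n,k)·QₖP_{n−k}`.
[cite: Hoffman1999DerivativePolynomials, §2 eq. (3) (coefficient of `s¹tⁿ/n!` in `Q(P(u,t),s)Q(u,t) = Q(u,t+s)`)] -/
theorem Q_succ_eq_sum (n : ℕ) :
    TangentNumbers.Q (n + 1) =
      ∑ k ∈ range (n + 1), n.choose k • (TangentNumbers.Q k * TangentNumbers.P (n - k)) := by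
  apply Polynomial.map_injective (Nat.castRingHom ℚ) Nat.cast_injective
  apply Polynomial.funext
  intro u
  rw [← aeval_nat_eq, aeval_Q_succ, Polynomial.map_sum, Polynomial.eval_finsetSum]
  refine sum_congr rfl fun k _ => ?_
  rw [nsmul_eq_mul, Polynomial.map_mul, Polynomial.map_mul, Polynomial.map_natCast, Polynomial.eval_mul,
    Polynomial.eval_mul, Polynomial.eval_natCast, ← aeval_nat_eq, ← aeval_nat_eq, mul_assoc]

/-- ★ **Theorem 3.1 in general form**: `u·Q(u,t) = cos t·P(u,t) − sin t` (both sides equal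
`u/(cos t − u sin t)` by `sin² + cos² = 1`). [cite: Hoffman1999DerivativePolynomials, §3 Theorem 3.1 (proof)] -/
theorem C_mul_egfQ (u : K) : C u * egfQ u = PowerSeries.cos K * egfP u - PowerSeries.sin K := by
  set N := PowerSeries.sin K + C u * PowerSeries.cos K with hN
  set D := PowerSeries.cos K - C u * PowerSeries.sin K with hD
  have hDD : D * D⁻¹ = 1 := den_mul_inv u
  have key : PowerSeries.cos K * N - PowerSeries.sin K * D = C u := by
    rw [hN, hD]; linear_combination (C u) * sin_sq_add_cos_sq_eq (K := K)
  rw [egfQ_eq, egfP_eq, ← hN, ← hD]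
  calc C u * D⁻¹ = (PowerSeries.cos K * N - PowerSeries.sin K * D) * D⁻¹ := by rw [key]
    _ = PowerSeries.cos K * (N * D⁻¹) - PowerSeries.sin K * (D * D⁻¹) := by ring
    _ = PowerSeries.cos K * (N * D⁻¹) - PowerSeries.sin K := by rw [hDD, mul_one]

/-- ★★ **Theorem 3.1, coefficient form at general `u`**:
`u·Qₙ(u) + sin(nπ/2) = Σ_{2k≤n} (−1)ᵏ binom(n,2k) P_{n−2k}(u)`, where `sin(nπ/2) = n!·[tⁿ] sin t` is `0`
for even `n` and `(−1)^{(n−1)/2}` for odd `n`.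
[cite: Hoffman1999DerivativePolynomials, §3 Theorem 3.1] -/
theorem mul_aeval_Q_add (u : K) (n : ℕ) :
    u * Polynomial.aeval u (TangentNumbers.Q n) + (if Even n then 0 else (-1 : K) ^ (n / 2)) =
      ∑ k ∈ range (n / 2 + 1), (-1 : K) ^ k * (n.choose (2 * k) : K) *
        Polynomial.aeval u (TangentNumbers.P (n - 2 * k)) := by
  have h := PowerSeries.ext_iff.1 (C_mul_egfQ u) n
  rw [coeff_C_mul, coeff_egfQ, map_sub, cos_eq_mk, egfP, coeff_egf_mul, coeff_sin_eq] at h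
  have hn : (n ! : K) ≠ 0 := Nat.cast_ne_zero.2 (Nat.factorial_ne_zero n)
  have h' : u * Polynomial.aeval u (TangentNumbers.Q n) + (if Even n then 0 else (-1 : K) ^ (n / 2)) =
      ∑ j ∈ range (n + 1), (n.choose j : K) * (if Even j then (-1 : K) ^ (j / 2) else 0) *
        Polynomial.aeval u (TangentNumbers.P (n - j)) := by
    field_simp at h
    linear_combination h
  rw [h', show (∑ j ∈ range (n + 1), (n.choose j : K) * (if Even j then (-1 : K) ^ (j / 2) else 0) *
        Polynomial.aeval u (TangentNumbers.P (n - j))) =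
      ∑ j ∈ range (n + 1), (if Even j then (-1 : K) ^ (j / 2) * (n.choose j : K) *
        Polynomial.aeval u (TangentNumbers.P (n - j)) else 0) from
      sum_congr rfl fun j _ => by split_ifs <;> ring,
    sum_range_succ_even (fun j => (-1 : K) ^ (j / 2) * (n.choose j : K) *
      Polynomial.aeval u (TangentNumbers.P (n - j))) n]
  refine sum_congr rfl fun k _ => ?_
  rw [Nat.mul_div_cancel_left _ (by norm_num : 0 < 2)]

end EGF

/-! ### §3 `u = 0`: tangent and secant numbers (junction with the Euler zigzag numbers `Eₙ`) -/

section AtZero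

/-- `P(0,t) = tan t` (the tree's `tanSeries = sin·cos⁻¹`).
[cite: Hoffman1999DerivativePolynomials, §3 («By setting u = 0 in equations (1) we see that P_n(0) and Q_n(0) are respectively the tangent and secant numbers»)] -/
theorem egfP_zero : egfP (0 : ℚ) = tanSeries := by
  have h := egfP_eq (0 : ℚ)
  rw [map_zero, zero_mul, add_zero, zero_mul, sub_zero] at h
  rw [tanSeries]
  convert h <;> exact Subsingleton.elim _ _

/-- `Q(0,t) = sec t` (the tree's `secSeries = cos⁻¹`). [cite: Hoffman1999DerivativePolynomials, §3 (u = 0)] -/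
theorem egfQ_zero : egfQ (0 : ℚ) = secSeries := by
  have h := egfQ_eq (0 : ℚ)
  rw [map_zero, zero_mul, sub_zero] at h
  rw [secSeries]
  convert h
  exact Subsingleton.elim _ _

/-- **`Pₙ(0)` is the `n`-th tangent number**: `Pₙ(0) = Eₙ` for odd `n` and `0` for even `n`
(`Eₙ` = the tree's Euler zigzag number `eulerZigzag n`).
[cite: Hoffman1999DerivativePolynomials, §3 («P_n(0) and Q_n(0) are respectively the tangent and secant numbers»)] -/
theorem p_zero_eq (n : ℕ) : TangentNumbers.p n 0 = if Even n then 0 else eulerZigzag n := by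
  have h := factorial_mul_coeff_tanSeries n
  rw [coeff_tanSeries] at h
  split_ifs at h ⊢ with hn
  · rw [mul_zero] at h; exact_mod_cast h.symm
  · rw [mul_div_cancel₀ _ (by positivity)] at h; exact_mod_cast h.symm

/-- **`Qₙ(0)` is the `n`-th secant number**: `Qₙ(0) = Eₙ` for even `n` and `0` for odd `n`.
[cite: Hoffman1999DerivativePolynomials, §3 («P_n(0) and Q_n(0) are respectively the tangent and secant numbers»)] -/
theorem q_zero_eq (n : ℕ) : TangentNumbers.q n 0 = if Even n then eulerZigzag n else 0 := by
  have h := factorial_mul_coeff_secSeries n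
  rw [coeff_secSeries] at h
  split_ifs at h ⊢ with hn
  · rw [mul_div_cancel₀ _ (by positivity)] at h; exact_mod_cast h.symm
  · rw [mul_zero] at h; exact_mod_cast h.symm

/-- `Pₙ(0) = Eₙ·[n odd]` for the polynomial `Pₙ ∈ ℕ[X]`. [cite: Hoffman1999DerivativePolynomials, §3 (u = 0)] -/
theorem eval_zero_P (n : ℕ) : (TangentNumbers.P n).eval 0 = if Even n then 0 else eulerZigzag n := by
  rw [← Polynomial.coeff_zero_eq_eval_zero, TangentNumbers.coeff_P, p_zero_eq]

/-- `Qₙ(0) = Eₙ·[n even]` for the polynomial `Qₙ ∈ ℕ[X]`. [cite: Hoffman1999DerivativePolynomials, §3 (u = 0)] -/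
theorem eval_zero_Q (n : ℕ) : (TangentNumbers.Q n).eval 0 = if Even n then eulerZigzag n else 0 := by
  rw [← Polynomial.coeff_zero_eq_eval_zero, TangentNumbers.coeff_Q, q_zero_eq]

/-- ★ **`Pₙ(0) + Qₙ(0) = Eₙ`, the `n`-th André number** («while Pₙ(0) + Qₙ(0) is the nth André number»;
Proposition 4.1: the Springer number of type `A_{n−1}` is `a_{n−1} = Pₙ(0) + Qₙ(0)`, and
`1 + t + Σ_{n≥2} a_{n−1}tⁿ/n! = tan t + sec t`).
[cite: Hoffman1999DerivativePolynomials, Abstract and §4 Proposition 4.1 («a_n = P_{n+1}(0) + Q_{n+1}(0)»)] -/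
theorem eval_zero_P_add_eval_zero_Q (n : ℕ) :
    (TangentNumbers.P n).eval 0 + (TangentNumbers.Q n).eval 0 = eulerZigzag n := by
  rw [eval_zero_P, eval_zero_Q]
  split_ifs <;> simp

end AtZero

/-! ### §4 `u = 1`: `P(1,t) = tan 2t + sec 2t`, equation (5), and the Springer numbers `bₙ = Qₙ(1)` -/

section AtOne

/-- ★★ **`P(1,t) = tan 2t + sec 2t`** (`= tan(t + π/4)`): both sides solve `y′ = 1 + y²`, `y(0) = 1`.
This is equation (5) at the level of generating functions: `P(1,t) = P(0,2t) + Q(0,2t)`.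
[cite: Hoffman1999DerivativePolynomials, §3 eq. (5) and §4 proof of Theorem 4.2 («β(t) = tan(t + π/4) = (tan t + 1)/(1 − tan t) = P(1,t)»)] -/
theorem egfP_one : egfP (1 : ℚ) = rescale 2 (tanSeries + secSeries) := by
  set y := rescale 2 (tanSeries + secSeries) with hy
  have h1 : d⁄dX ℚ y = 2 * rescale 2 (1 + tanSeries ^ 2 + secSeries * tanSeries) := by
    rw [hy, derivative_rescale, map_add (d⁄dX ℚ), derivative_tanSeries, derivative_secSeries, map_ofNat]
  have h2 : (1 : ℚ⟦X⟧) + y ^ 2 = 2 * rescale 2 (1 + tanSeries ^ 2 + secSeries * tanSeries) := by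
    have h : (1 : ℚ⟦X⟧) + (tanSeries + secSeries) ^ 2 =
        2 * (1 + tanSeries ^ 2 + secSeries * tanSeries) := by
      linear_combination secSeries_sq
    rw [hy, ← map_pow]
    conv_lhs => rw [← (rescale (2 : ℚ)).map_one, ← map_add, h, map_mul, map_ofNat]
  have hy' : d⁄dX ℚ y = 1 + y ^ 2 := by rw [h1, h2]
  have hw : d⁄dX ℚ (egfP 1 - y) = (egfP 1 - y) * (egfP 1 + y) := by
    rw [map_sub, derivative_egfP, hy']; ring
  have h0 : constantCoeff (egfP (1 : ℚ) - y) = 0 := by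
    have hc : constantCoeff y = 1 := by
      rw [hy, ← coeff_zero_eq_constantCoeff_apply, coeff_rescale, pow_zero, one_mul,
        coeff_zero_eq_constantCoeff_apply, map_add, constantCoeff_tanSeries, constantCoeff_secSeries,
        zero_add]
    rw [map_sub, constantCoeff_egfP, hc, sub_self]
  exact sub_eq_zero.1 (eq_zero_of_derivative_eq_mul hw h0)

/-- ★★★ **`Pₙ(1) = 2ⁿEₙ`** (equation (5): `Pₙ(1) = 2ⁿ(Pₙ(0) + Qₙ(0))`, i.e. `2ⁿQₙ(0)` for even `n` and
`2ⁿPₙ(0)` for odd `n`; by Theorem 4.2 this is the number of snakes of type `βₙ`, «card βₙ = 2ⁿa_{n−1}»).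
[cite: Hoffman1999DerivativePolynomials, §3 eq. (5) («Pₙ(1) = 2ⁿ(Pₙ(0) + Qₙ(0))»)] -/
theorem eval_one_P (n : ℕ) : (TangentNumbers.P n).eval 1 = 2 ^ n * eulerZigzag n := by
  have h := PowerSeries.ext_iff.1 egfP_one n
  rw [coeff_egfP, aeval_one_nat, coeff_rescale, map_add, coeff_tanSeries, coeff_secSeries] at h
  have h' : ((if Even n then (0 : ℚ) else eulerZigzag n / n !) +
      if Even n then (eulerZigzag n : ℚ) / n ! else 0) = eulerZigzag n / n ! := by
    split_ifs <;> simp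
  rw [h'] at h
  field_simp at h
  exact_mod_cast h

/-- Equation (5) as printed: `Pₙ(1) = 2ⁿ(Pₙ(0) + Qₙ(0))`. [cite: Hoffman1999DerivativePolynomials, §3 eq. (5)] -/
theorem eval_one_P_eq (n : ℕ) :
    (TangentNumbers.P n).eval 1 = 2 ^ n * ((TangentNumbers.P n).eval 0 + (TangentNumbers.Q n).eval 0) := by
  rw [eval_one_P, eval_zero_P_add_eval_zero_Q]

/-- `Q(1,t)·(cos t − sin t) = 1`, i.e. **`Σ Qₙ(1) tⁿ/n! = 1/(cos t − sin t)`** — the exponential generating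
function of the numbers `bₙ = Qₙ(1)` (the Springer numbers of type `Bₙ`, Proposition 4.1; Glaisher's
numbers, Remark 3 of §3). [cite: Hoffman1999DerivativePolynomials, §4 Proposition 4.1 («Q(1,t) = 1/(cos t − sin t) = (cos t + sin t)/cos 2t»)] -/
theorem egfQ_one_mul : egfQ (1 : ℚ) * (PowerSeries.cos ℚ - PowerSeries.sin ℚ) = 1 := by
  have h := egfQ_mul_den (1 : ℚ)
  rw [map_one, one_mul] at h
  convert h <;> exact Subsingleton.elim _ _

/-- `P(1,t)·(cos t − sin t) = sin t + cos t`. [cite: Hoffman1999DerivativePolynomials, §4 proof of Theorem 4.2 («β(t) = (tan t + 1)/(1 − tan t) = P(1,t)»)] -/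
theorem egfP_one_mul :
    egfP (1 : ℚ) * (PowerSeries.cos ℚ - PowerSeries.sin ℚ) = PowerSeries.sin ℚ + PowerSeries.cos ℚ := by
  have h := egfP_mul_den (1 : ℚ)
  rw [map_one, one_mul, one_mul] at h
  convert h <;> exact Subsingleton.elim _ _

/-- `sin 2t = 2 sin t cos t` over `ℚ` (for the tree's `ℚ`-valued `sin`, `cos`). [cite: Hoffman1999DerivativePolynomials, §4 proof of Proposition 4.1 («1 + sin 2t»)] -/
theorem rescale_two_sin_rat :
    rescale 2 (PowerSeries.sin ℚ) = 2 * PowerSeries.sin ℚ * PowerSeries.cos ℚ := by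
  convert rescale_two_sin (K := ℚ) <;> exact Subsingleton.elim _ _

/-- `cos 2t = cos² t − sin² t` over `ℚ`. [cite: Hoffman1999DerivativePolynomials, §4 proof of Proposition 4.1 («cos 2t»)] -/
theorem rescale_two_cos_rat :
    rescale 2 (PowerSeries.cos ℚ) = PowerSeries.cos ℚ ^ 2 - PowerSeries.sin ℚ ^ 2 := by
  convert rescale_two_cos (K := ℚ) <;> exact Subsingleton.elim _ _

/-- ★ **Proposition 4.1 (type B)**: `Q(1,t)·cos 2t = cos t + sin t`, i.e.
`1 + t + Σ_{n≥2} bₙtⁿ/n! = (cos t + sin t)/cos 2t` with `bₙ = Qₙ(1)` — Springer's generating function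
for the root systems `Bₙ`/`Cₙ`. [cite: Hoffman1999DerivativePolynomials, §4 Proposition 4.1 («b_n = Q_n(1)», «(cos t + sin t)/cos 2t»); Springer1971Remarks] -/
theorem egfQ_one_mul_cos_two :
    egfQ (1 : ℚ) * rescale 2 (PowerSeries.cos ℚ) = PowerSeries.cos ℚ + PowerSeries.sin ℚ := by
  rw [rescale_two_cos_rat, sq_sub_sq, mul_comm (PowerSeries.cos ℚ + PowerSeries.sin ℚ), ← mul_assoc,
    egfQ_one_mul, one_mul]

/-- ★ **Proposition 4.1 (type D)**: `(P(1,t) − Q(1,t))·cos 2t = 1 + sin 2t − cos t − sin t`, i.e.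
`Σ dₙtⁿ/n! = (1 + sin 2t − cos t − sin t)/cos 2t` with `dₙ = Pₙ(1) − Qₙ(1)` — Springer's generating
function for the root systems `Dₙ`. [cite: Hoffman1999DerivativePolynomials, §4 Proposition 4.1 («d_n = P_n(1) − Q_n(1)», «P(1,t) − Q(1,t) = (1 + sin 2t − cos t − sin t)/cos 2t»); Springer1971Remarks] -/
theorem egfP_sub_egfQ_one_mul_cos_two :
    (egfP (1 : ℚ) - egfQ 1) * rescale 2 (PowerSeries.cos ℚ) =
      1 + rescale 2 (PowerSeries.sin ℚ) - PowerSeries.cos ℚ - PowerSeries.sin ℚ := by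
  rw [rescale_two_cos_rat, sq_sub_sq, mul_comm (PowerSeries.cos ℚ + PowerSeries.sin ℚ), ← mul_assoc,
    sub_mul, egfQ_one_mul, egfP_one_mul, rescale_two_sin_rat]
  linear_combination sin_sq_add_cos_sq

/-- ★★ **Recurrence for the Springer numbers `bₙ = Qₙ(1)`**:
`bₙ₊₁ = Σₖ binom(n,k) bₖ · 2^{n−k}E_{n−k}` (the coefficient form of `b′(t) = b(t)β(t)` with
`β(t) = P(1,t) = Σ 2ᵐEₘtᵐ/m!`). [cite: Hoffman1999DerivativePolynomials, §4 proof of Theorem 4.2 («card B_{n+1} = Σ_r binom(n,r) card B_r card β_{n−r}», «b′(t) = b(t)β(t)»)] -/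
theorem eval_one_Q_succ (n : ℕ) :
    (TangentNumbers.Q (n + 1)).eval 1 = ∑ k ∈ range (n + 1),
      n.choose k * (TangentNumbers.Q k).eval 1 * (2 ^ (n - k) * eulerZigzag (n - k)) := by
  have h := aeval_Q_succ (1 : ℚ) n
  simp only [aeval_one_nat, eval_one_P] at h
  exact_mod_cast h

/-- `Pₙ₊₁(1) = δ_{n0} + Σₖ binom(n,k) Pₖ(1) P_{n−k}(1)` (the coefficient form of `β′ = β² + 1`, «The Kronecker
delta term reflects the fact that there are two β₁-snakes»).
[cite: Hoffman1999DerivativePolynomials, §4 proof of Theorem 4.2 («card β_{n+1} = Σ_r binom(n,r) card β_r card β_{n−r} + δ_{n0}»)] -/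
theorem eval_one_P_succ (n : ℕ) :
    (TangentNumbers.P (n + 1)).eval 1 = (if n = 0 then 1 else 0) + ∑ k ∈ range (n + 1),
      n.choose k * (TangentNumbers.P k).eval 1 * (TangentNumbers.P (n - k)).eval 1 := by
  have h := aeval_P_succ (1 : ℚ) n
  simp only [aeval_one_nat] at h
  have h' : ((if n = 0 then (1 : ℚ) else 0)) = ((if n = 0 then 1 else 0 : ℕ) : ℚ) := by
    split_ifs <;> simp
  rw [h'] at h
  exact_mod_cast h

/-- ★★ **Theorem 3.1**: `Qₙ(1) = −sin(nπ/2) + Σ_{2k≤n} binom(n,2k)(−1)ᵏ P_{n−2k}(1)` (in `ℤ`; `sin(nπ/2)` is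
`0` for even `n`, `(−1)^{(n−1)/2}` for odd `n`).
[cite: Hoffman1999DerivativePolynomials, §3 Theorem 3.1 («Q_n(1) = −sin(nπ/2) + Σ_{2k≤n} binom(n,2k)(−1)^k P_{n−2k}(1)»)] -/
theorem eval_one_Q_eq (n : ℕ) :
    (((TangentNumbers.Q n).eval 1 : ℕ) : ℤ) = -(if Even n then 0 else (-1 : ℤ) ^ (n / 2)) +
      ∑ k ∈ range (n / 2 + 1), (n.choose (2 * k) : ℤ) * (-1) ^ k *
        (((TangentNumbers.P (n - 2 * k)).eval 1 : ℕ) : ℤ) := by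
  have h := mul_aeval_Q_add (1 : ℚ) n
  simp only [aeval_one_nat, one_mul] at h
  have h' : (((TangentNumbers.Q n).eval 1 : ℕ) : ℚ) = -(if Even n then 0 else (-1 : ℚ) ^ (n / 2)) +
      ∑ k ∈ range (n / 2 + 1), (n.choose (2 * k) : ℚ) * (-1) ^ k *
        (((TangentNumbers.P (n - 2 * k)).eval 1 : ℕ) : ℚ) := by
    have hs : (∑ k ∈ range (n / 2 + 1), (-1 : ℚ) ^ k * (n.choose (2 * k) : ℚ) *
        (((TangentNumbers.P (n - 2 * k)).eval 1 : ℕ) : ℚ)) =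
        ∑ k ∈ range (n / 2 + 1), (n.choose (2 * k) : ℚ) * (-1) ^ k *
        (((TangentNumbers.P (n - 2 * k)).eval 1 : ℕ) : ℚ) := sum_congr rfl fun k _ => by ring
    rw [← hs]
    linear_combination h
  apply Int.cast_injective (α := ℚ)
  push_cast
  exact h'

/-- `Qₙ(1) = Σⱼ q_{n,j}` (sum of the coefficients of `Qₙ`). [cite: Hoffman1999DerivativePolynomials, §3 Remark 3 («The numbers Q_n(1) were extensively studied by Glaisher»)] -/
theorem eval_one_Q_eq_sum (n : ℕ) :
    (TangentNumbers.Q n).eval 1 = ∑ j ∈ range (n + 1), TangentNumbers.q n j := by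
  rw [Polynomial.eval_eq_sum_range' (lt_of_le_of_lt (TangentNumbers.natDegree_Q n).le (Nat.lt_succ_self n))]
  simp [TangentNumbers.coeff_Q]

/-- `Pₙ(1) = Σⱼ p_{n,j}`. [cite: Hoffman1999DerivativePolynomials, §3 eq. (5)] -/
theorem eval_one_P_eq_sum (n : ℕ) :
    (TangentNumbers.P n).eval 1 = ∑ j ∈ range (n + 2), TangentNumbers.p n j := by
  rw [Polynomial.eval_eq_sum_range' (lt_of_le_of_lt (TangentNumbers.natDegree_P n).le (Nat.lt_succ_self _))]
  simp [TangentNumbers.coeff_P]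

/-- ★ **The Springer numbers of type `B`**: `b₀,…,b₇ = Q₀(1),…,Q₇(1) = 1, 1, 3, 11, 57, 361, 2763, 24611`.
[cite: Hoffman1999DerivativePolynomials, §4 Proposition 4.1 («b_n = Q_n(1)»); Arnold1992Snakes] -/
theorem eval_one_Q_values :
    [(TangentNumbers.Q 0).eval 1, (TangentNumbers.Q 1).eval 1, (TangentNumbers.Q 2).eval 1,
      (TangentNumbers.Q 3).eval 1, (TangentNumbers.Q 4).eval 1, (TangentNumbers.Q 5).eval 1,
      (TangentNumbers.Q 6).eval 1, (TangentNumbers.Q 7).eval 1] = [1, 1, 3, 11, 57, 361, 2763, 24611] := by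
  simp only [eval_one_Q_eq_sum]
  decide

/-- `P₀(1),…,P₆(1) = 1, 2, 4, 16, 80, 512, 3904` (`= 2ⁿEₙ`; the number of snakes of type `βₙ`).
[cite: Hoffman1999DerivativePolynomials, §3 eq. (5) and §4 Theorem 4.2 («card βₙ = Pₙ(1)»)] -/
theorem eval_one_P_values :
    [(TangentNumbers.P 0).eval 1, (TangentNumbers.P 1).eval 1, (TangentNumbers.P 2).eval 1,
      (TangentNumbers.P 3).eval 1, (TangentNumbers.P 4).eval 1, (TangentNumbers.P 5).eval 1,
      (TangentNumbers.P 6).eval 1] = [1, 2, 4, 16, 80, 512, 3904] := by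
  simp only [eval_one_P_eq_sum]
  decide

/-- ★ **The Springer numbers of type `D`**: `dₙ = Pₙ(1) − Qₙ(1)` for `n = 1,…,7` are
`1, 1, 5, 23, 151, 1141, 10205`. [cite: Hoffman1999DerivativePolynomials, §4 Proposition 4.1 («d_n = P_n(1) − Q_n(1)»); Arnold1992Snakes] -/
theorem springerD_values :
    [(TangentNumbers.P 1).eval 1 - (TangentNumbers.Q 1).eval 1,
      (TangentNumbers.P 2).eval 1 - (TangentNumbers.Q 2).eval 1,
      (TangentNumbers.P 3).eval 1 - (TangentNumbers.Q 3).eval 1,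
      (TangentNumbers.P 4).eval 1 - (TangentNumbers.Q 4).eval 1,
      (TangentNumbers.P 5).eval 1 - (TangentNumbers.Q 5).eval 1,
      (TangentNumbers.P 6).eval 1 - (TangentNumbers.Q 6).eval 1,
      (TangentNumbers.P 7).eval 1 - (TangentNumbers.Q 7).eval 1] = [1, 1, 5, 23, 151, 1141, 10205] := by
  simp only [eval_one_P_eq_sum, eval_one_Q_eq_sum]
  decide

/-- `Qₙ(1) ≤ Pₙ(1)` (so `dₙ = Pₙ(1) − Qₙ(1)` involves no truncation): from the recurrences, by induction.
[cite: Hoffman1999DerivativePolynomials, §4 Theorem 4.3 («card βₙ = card Bₙ + card Dₙ»)] -/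
theorem eval_one_Q_le_eval_one_P (n : ℕ) : (TangentNumbers.Q n).eval 1 ≤ (TangentNumbers.P n).eval 1 := by
  induction n using Nat.strong_induction_on with
  | _ n ih =>
    cases n with
    | zero => simp [TangentNumbers.Q, TangentNumbers.P_zero]
    | succ n =>
        rw [eval_one_Q_succ, eval_one_P_succ]
        refine le_add_left (sum_le_sum fun k hk => ?_)
        rw [← eval_one_P]
        exact Nat.mul_le_mul_right _ (Nat.mul_le_mul_left _ (ih k (mem_range.1 hk)))

end AtOne

/-! ### §5 Theorem 2.1: parity of `Pₙ`, `Qₙ` and positivity of the coefficients of `Qₙ` -/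

section Parity

/-- **Theorem 2.1 (positivity for `Qₙ`)**: the coefficient `q_{n,j}` of `uʲ` in `Qₙ` is positive when
`n + j` is even and `j ≤ n` (the tree's `p_pos` is the statement for `Pₙ`).
[cite: Hoffman1999DerivativePolynomials, §2 Theorem 2.1 («Q_n(u) is a polynomial of degree n consisting of even powers with positive integral coefficients when n is even and of odd powers with positive integral coefficients when n is odd»)] -/
theorem q_pos : ∀ (n : ℕ) {j : ℕ}, (n + j) % 2 = 0 → j ≤ n → 0 < TangentNumbers.q n j
  | 0, j, h1, h2 => by
      obtain rfl : j = 0 := by omega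
      simp
  | n + 1, j, h1, h2 => by
      rw [TangentNumbers.q_succ]
      rcases Nat.eq_zero_or_pos j with rfl | hj
      · have h := q_pos n (j := 1) (by omega) (by omega)
        simpa using h
      · have h := q_pos n (j := j - 1) (by omega) (by omega)
        exact Nat.lt_of_lt_of_le (Nat.mul_pos hj h) (Nat.le_add_right _ _)

variable {R : Type*} [CommRing R]

/-- **Theorem 2.1 (parity of `Pₙ`)**: `Pₙ(−u) = (−1)ⁿ⁺¹Pₙ(u)`.
[cite: Hoffman1999DerivativePolynomials, §2 Theorem 2.1 («P_n(−u) = (−1)^{n+1} P_n(u)»)] -/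
theorem aeval_neg_P (u : R) (n : ℕ) :
    Polynomial.aeval (-u) (TangentNumbers.P n) = (-1) ^ (n + 1) * Polynomial.aeval u (TangentNumbers.P n) := by
  rw [Polynomial.aeval_eq_sum_range' (lt_of_le_of_lt (TangentNumbers.natDegree_P n).le (Nat.lt_succ_self _)),
    Polynomial.aeval_eq_sum_range' (lt_of_le_of_lt (TangentNumbers.natDegree_P n).le (Nat.lt_succ_self _)),
    mul_sum]
  refine sum_congr rfl fun j _ => ?_
  rw [TangentNumbers.coeff_P]
  rcases Nat.even_or_odd (n + j) with h | h
  · rw [TangentNumbers.p_eq_zero_of_even n (Nat.even_iff.1 h), zero_smul, zero_smul, mul_zero]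
  · rw [neg_pow, neg_one_pow_eq_pow_mod_two (R := R) (n := j),
      neg_one_pow_eq_pow_mod_two (R := R) (n := n + 1),
      show j % 2 = (n + 1) % 2 by rcases h with ⟨m, hm⟩; omega, nsmul_eq_mul, nsmul_eq_mul]
    ring

/-- **Theorem 2.1 (parity of `Qₙ`)**: `Qₙ(−u) = (−1)ⁿQₙ(u)`.
[cite: Hoffman1999DerivativePolynomials, §2 Theorem 2.1 («Q_n(−u) = (−1)^n Q_n(u)»)] -/
theorem aeval_neg_Q (u : R) (n : ℕ) :
    Polynomial.aeval (-u) (TangentNumbers.Q n) = (-1) ^ n * Polynomial.aeval u (TangentNumbers.Q n) := by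
  rw [Polynomial.aeval_eq_sum_range' (lt_of_le_of_lt (TangentNumbers.natDegree_Q n).le (Nat.lt_succ_self _)),
    Polynomial.aeval_eq_sum_range' (lt_of_le_of_lt (TangentNumbers.natDegree_Q n).le (Nat.lt_succ_self _)),
    mul_sum]
  refine sum_congr rfl fun j _ => ?_
  rw [TangentNumbers.coeff_Q]
  rcases Nat.even_or_odd (n + j) with h | h
  · rw [neg_pow, neg_one_pow_eq_pow_mod_two (R := R) (n := j),
      neg_one_pow_eq_pow_mod_two (R := R) (n := n),
      show j % 2 = n % 2 by rcases h with ⟨m, hm⟩; omega, nsmul_eq_mul, nsmul_eq_mul]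
    ring
  · rw [TangentNumbers.q_eq_zero_of_odd n (Nat.odd_iff.1 h), zero_smul, zero_smul, mul_zero]

end Parity

end DerivativePolynomials
end Literature.Combinatorics.Enumerative
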